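import Summits.ValiantsHypothesis.ValiantsHypothesis.Theorems.SymPencilPerFourPeeledTwoPencilChordW0Q

/-!
# Route `SymPencil` — inner rank of the `2 | 2` row split of `per_4`, PEELED case: the class
# «swap pair + rank-one third column» of the (8,8,11) coverage programme, by the `W₀` chart
# (`--supports` stmt-ValiantsHypothesis-5674 `SdcSuperquadratic`; (8,8) column, memo
# `NOTE-p8g15-5674-R2-two-pencil.md` §9.6/§9.7 (class R2, the sub-case Case A misses); rung
# currency only)

Class lemma in the currency of `…TwoPencilFrameless.false_of_peeled_of_frame_at` (the matrix-level
frame body): `Ψ = λ(E₀₁ + E₁₀) + c₀E₀₂ + c₁E₁₂` with `λ ≠ 0` and `(c₀, c₁) ≠ (0, 0)` — one zero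
column `3`, the swap pair `{0,1}`, and a third column `c₀e₀ + c₁e₁` supported on the swap rows (its
transpose `λ(E₀₁+E₁₀) + c₀E₂₀ + c₁E₂₁` is the one two-zero-columns class with three non-zero rows
that the Case-A class theorem `…TwoPencilCaseAParams.hframes_of_caseA_class` does not reach).  Frame:
`a₀ = (1, 1, λ/(c₀+c₁), 1)` if `c₀ + c₁ ≠ 0`, else `a₀ = (1, 2, 2λ/(c₀+2c₁), 1)`; then
`a₀ ∘ Ψᵀa₀ ∝ (1,1,1,0)`, so the incidences of the numeric chart
`…TwoPencilChordW0Q.frames_of_W0_of_indep` (`z₀ = (−3,−1,4,−2)`, `z₁ = (−2,−3,5,0)`) hold;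
`a₁ := a₀ + e₃` (row `3` of `Ψ` vanishes, `a₁ ∉ K a₀`).

Honest framing: class lemma; no cell closes here; the window `28 ≤ sdc(per₄) ≤ 29` of record, the
crux `SdcSuperquadratic` and `VP ≠ VNP` are untouched.  No definitions, no named facts. [folklore]
-/

noncomputable section

-- single-conjunct layout: Sub = Summit, duplicated namespace component intended
set_option linter.dupNamespace false

namespace Summit.ValiantsHypothesis.ValiantsHypothesis.Theorems.SymPencilPerFourPeeledTwoPencilSwapRankOne

open Matrix Finset Module
open Summit.ValiantsHypothesis.ValiantsHypothesis.Theorems.SymPencilPerFourPeeledTwoPencilChordW0Q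

universe u

variable {K : Type u} [Field K]

/-- **Class R2, rank-one third column on the swap rows: `Ψ = λ(E₀₁+E₁₀) + c₀E₀₂ + c₁E₁₂`.**
[folklore] -/
theorem frames_of_swap_plus_rank_one [CharZero K] (Ψ : Matrix (Fin 4) (Fin 4) K) (la c₀ c₁ : K)
    (hla : la ≠ 0) (hc : c₀ ≠ 0 ∨ c₁ ≠ 0)
    (hΨ : Ψ = !![0, la, c₀, 0; la, 0, c₁, 0; 0, 0, 0, 0; 0, 0, 0, 0]) :
    ∃ (a₀ a₁ y₀ y₁ : Fin 4 → K) (P₀₀ P₁₀ P₀₁ P₁₁ W₀ : Matrix (Fin 4) (Fin 4) K)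
        (v : Fin 4 → Fin 4 → K) (s : Fin 4 → K) (W : Matrix (Fin 4) (Fin 4) K),
        a₀ ⬝ᵥ Ψ *ᵥ y₀ = 0 ∧ a₀ ⬝ᵥ Ψ *ᵥ y₁ = 0 ∧ a₁ ⬝ᵥ Ψ *ᵥ y₀ = 0 ∧ a₁ ⬝ᵥ Ψ *ᵥ y₁ = 0 ∧
        (∀ b l, P₀₀ b l = (Matrix.of ![a₀, Pi.single b 1, y₀, Pi.single l 1]).permanent) ∧
        (∀ b l, P₁₀ b l = (Matrix.of ![a₀, Pi.single b 1, y₁, Pi.single l 1]).permanent) ∧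
        (∀ b l, P₀₁ b l = (Matrix.of ![a₁, Pi.single b 1, y₀, Pi.single l 1]).permanent) ∧
        (∀ b l, P₁₁ b l = (Matrix.of ![a₁, Pi.single b 1, y₁, Pi.single l 1]).permanent) ∧
        W₀ * P₀₀ = 1 ∧ (∀ j, P₁₀ *ᵥ v j = s j • P₀₀ *ᵥ v j) ∧ (∀ i j, i ≠ j → s i ≠ s j) ∧
        W * Matrix.of v = 1 ∧ P₁₁ - P₁₀ * W₀ * P₀₁ ≠ 0 := by
  by_cases hs : c₀ + c₁ = 0
  · -- then `c₀ ≠ 0`, `c₁ = -c₀`, and `c₀ + 2c₁ = -c₀ ≠ 0`: use `a₀ = (1, 2, 2λ/(c₀+2c₁), 1)`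
    have hc₀ : c₀ ≠ 0 := by
      rcases hc with h | h
      · exact h
      · intro h0; apply h; linear_combination hs - h0
    have hs2 : c₀ + 2 * c₁ ≠ 0 := by
      intro h; apply hc₀; linear_combination 2 * hs - h
    refine frames_of_W0_of_indep Ψ ![1, 2, 2 * la / (c₀ + 2 * c₁), 1]
      ![1, 2, 2 * la / (c₀ + 2 * c₁), 2] ?_ ?_ ?_ ?_ ?_ ?_
    · intro k
      fin_cases k
      · simp
      · simp
      · simpa using div_ne_zero (mul_ne_zero two_ne_zero hla) hs2
      · simp
    · intro m e
      have e0 := congr_fun e 0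
      have e3 := congr_fun e 3
      simp only [Pi.smul_apply, smul_eq_mul] at e0 e3
      have h0 : (![1, 2, 2 * la / (c₀ + 2 * c₁), 2] : Fin 4 → K) 0 = 1 := rfl
      have h0' : (![1, 2, 2 * la / (c₀ + 2 * c₁), 1] : Fin 4 → K) 0 = 1 := rfl
      have h3 : (![1, 2, 2 * la / (c₀ + 2 * c₁), 2] : Fin 4 → K) 3 = 2 := rfl
      have h3' : (![1, 2, 2 * la / (c₀ + 2 * c₁), 1] : Fin 4 → K) 3 = 1 := rfl
      rw [h0, h0'] at e0; rw [h3, h3'] at e3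
      have : (2 : K) = 1 := by linear_combination e3 - e0
      norm_num at this
    all_goals subst hΨ; simp [Matrix.mulVec, dotProduct, Fin.sum_univ_four]; field_simp; ring
  · -- `a₀ = (1, 1, λ/(c₀+c₁), 1)`
    refine frames_of_W0_of_indep Ψ ![1, 1, la / (c₀ + c₁), 1] ![1, 1, la / (c₀ + c₁), 2]
      ?_ ?_ ?_ ?_ ?_ ?_
    · intro k
      fin_cases k
      · simp
      · simp
      · simpa using div_ne_zero hla hs
      · simp
    · intro m e
      have e0 := congr_fun e 0
      have e3 := congr_fun e 3
      simp only [Pi.smul_apply, smul_eq_mul] at e0 e3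
      have h0 : (![1, 1, la / (c₀ + c₁), 2] : Fin 4 → K) 0 = 1 := rfl
      have h0' : (![1, 1, la / (c₀ + c₁), 1] : Fin 4 → K) 0 = 1 := rfl
      have h3 : (![1, 1, la / (c₀ + c₁), 2] : Fin 4 → K) 3 = 2 := rfl
      have h3' : (![1, 1, la / (c₀ + c₁), 1] : Fin 4 → K) 3 = 1 := rfl
      rw [h0, h0'] at e0; rw [h3, h3'] at e3
      have : (2 : K) = 1 := by linear_combination e3 - e0
      norm_num at this
    all_goals subst hΨ; simp [Matrix.mulVec, dotProduct, Fin.sum_univ_four]; field_simp; ring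

end Summit.ValiantsHypothesis.ValiantsHypothesis.Theorems.SymPencilPerFourPeeledTwoPencilSwapRankOne

end
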